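import Summits.RiemannHypothesis.RiemannHypothesis.Theorems.LiTailLaguerreFejerResidual
import Summits.RiemannHypothesis.RiemannHypothesis.Theorems.LiTailLaguerreFejer
import HarnessLib

/-!
# RiemannHypothesis / LiTailLaguerre — Fejér companion, part 7: inputs of the discrete Liouville–Green bootstrap —
# the telescoping majorant, the phase-hitting lemma, the weak law normalised (RH-FREE)

RH-FREE [rh-li-eng g6].  Cell `pub/rh-li`, PART K `Theorems/LiTailLaguerreDefs.lean`.  This file supplies the inputs of
`Theorems/LiTailLaguerreFejerStrong.lean` (`Fejer.sqrt_div_sq_le`, `Fejer.phi_step`,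
`Fejer.exists_hit`, `Fejer.weak_bound`), where PART K's last open companion becomes a theorem, `liCoffeyTermFejer_holds` — for every `m ≥ 2` there is `C` with
`|liCoffeyTerm m n + liPrimeEcho m n| ≤ C n^{−1/4}` for all `n ≥ 1` (Fejér 1909 / Perron 1921 / Szegő Thm 8.22.1 for
`α = 1`: `L¹_{n−1}(y) = π^{−1/2} e^{y/2} y^{−3/4} n^{1/4} cos(2√(ny) − 3π/4) + O(n^{−1/4})`).

METHOD (new here; no second-order stationary phase): let `u_n = liLaguerreOne n y`, `z_n = n^{1/4} e^{iφ_n}`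
(`φ_n = 2√(ny) + π/4`), `c = e^{y/2} π^{−1/2} y^{−3/4}`, `E_n = u_n + c Re z_n`.  (1) WEAK LAW: `|E_n| ≤ K` for
`n ≥ N₀` (`Fejer.bridge_asymptotic` + the Laguerre bridge `PrimeTail.integral_bridge_eq`).  (2) `u` satisfies
`u_{n+1} + u_{n−1} = (2 − y/n) u_n` exactly and `z` up to `r_n`, `‖r_n‖ ≤ 2(1+y+y²) n^{−7/4}` (`Fejer.norm_res_le`).
(3) The quasi-Casoratian `Z_n = E_n z_{n+1} − E_{n+1} z_n` has increments `Z_n − Z_{n−1} = E_n r_n − c z_n Re r_n`, of size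
`≤ A n^{−3/2}`, so `‖Z_p − Z_n‖ ≤ 2A/√n` for `p ≥ n`.  (4) `Im(z̄_p Z_p) = E_p · Im(z̄_p z_{p+1})` with
`Im(z̄_p z_{p+1}) ∈ [√y/2, 2√y]` (`Fejer.im_conj_zm_mul_bounds`), so `|Im(z̄_p Z_p)| ≤ 2K√y`; and since the phases `φ_p`
increase to `∞` by steps `≤ 1/2`, for every `n` there are arbitrarily large `p` with `Im(z̄_p Z_n) ≥ p^{1/4}‖Z_n‖/2`,
whence `p^{1/4}‖Z_n‖/2 ≤ 2K√y + p^{1/4}·2A/√n`, i.e. `‖Z_n‖ ≤ 4A/√n` (`p → ∞`).  (5) `|E_n|·√y/2 ≤ |Im(z̄_n Z_n)| ≤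
n^{1/4}‖Z_n‖ ≤ 4A n^{−1/4}`.  Nothing here bears on the truth of RH.
-/

noncomputable section

-- D-0017: `Summit.<S>.<S>.…` is the designed namespace of a single-problem summit.
set_option linter.dupNamespace false

open Complex MeasureTheory Set
open scoped ArithmeticFunction.vonMangoldt ComplexConjugate

namespace Summit.RiemannHypothesis.RiemannHypothesis.Theorems.LiTheory

namespace Fejer

/-! ### Elementary lemmas -/

/-- The telescoping majorant `√(m+1)/(m+1)² ≤ 2(1/√m − 1/√(m+1))` (`m ≥ 1`). -/
theorem sqrt_div_sq_le (m : ℕ) (hm : 1 ≤ m) :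
    Real.sqrt ((m : ℝ) + 1) / ((m : ℝ) + 1) ^ 2 ≤ 2 * (1 / Real.sqrt m - 1 / Real.sqrt ((m : ℝ) + 1)) := by
  have hm0 : (0 : ℝ) < m := by exact_mod_cast hm
  have hs0 : 0 < Real.sqrt m := Real.sqrt_pos.2 hm0
  have hs1 : 0 < Real.sqrt ((m : ℝ) + 1) := Real.sqrt_pos.2 (by linarith)
  have hle : Real.sqrt m ≤ Real.sqrt ((m : ℝ) + 1) := Real.sqrt_le_sqrt (by linarith)
  have hsq1 : Real.sqrt ((m : ℝ) + 1) * Real.sqrt ((m : ℝ) + 1) = m + 1 := Real.mul_self_sqrt (by linarith)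
  have hsq0 : Real.sqrt m * Real.sqrt m = m := Real.mul_self_sqrt hm0.le
  -- `(√(m+1) − √m)(√(m+1) + √m) = 1`, hence `1 ≤ 2(√(m+1) − √m)√(m+1)`
  have hprod : (Real.sqrt ((m : ℝ) + 1) - Real.sqrt m) * (Real.sqrt ((m : ℝ) + 1) + Real.sqrt m) = 1 := by
    nlinarith
  have hdiff : 1 ≤ 2 * (Real.sqrt ((m : ℝ) + 1) - Real.sqrt m) * Real.sqrt ((m : ℝ) + 1) := by
    nlinarith [sq_nonneg (Real.sqrt ((m : ℝ) + 1) - Real.sqrt m)]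
  rw [div_sub_div _ _ hs0.ne' hs1.ne', one_mul, mul_one, mul_div_assoc',
    div_le_div_iff₀ (by positivity) (by positivity)]
  -- goal: `√(m+1) * (√m * √(m+1)) ≤ 2 * (√(m+1) − √m) * (m+1)^2`
  have h1 : Real.sqrt ((m : ℝ) + 1) * (Real.sqrt m * Real.sqrt ((m : ℝ) + 1)) ≤ ((m : ℝ) + 1) * Real.sqrt ((m : ℝ) + 1) := by
    have : Real.sqrt m * Real.sqrt ((m : ℝ) + 1) ≤ Real.sqrt ((m : ℝ) + 1) * Real.sqrt ((m : ℝ) + 1) :=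
      mul_le_mul_of_nonneg_right hle hs1.le
    nlinarith
  have h2 : ((m : ℝ) + 1) * Real.sqrt ((m : ℝ) + 1) * 1
      ≤ ((m : ℝ) + 1) * Real.sqrt ((m : ℝ) + 1) * (2 * (Real.sqrt ((m : ℝ) + 1) - Real.sqrt m) * Real.sqrt ((m : ℝ) + 1)) :=
    mul_le_mul_of_nonneg_left hdiff (by positivity)
  have h3 : ((m : ℝ) + 1) * Real.sqrt ((m : ℝ) + 1) * (2 * (Real.sqrt ((m : ℝ) + 1) - Real.sqrt m) * Real.sqrt ((m : ℝ) + 1))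
      = 2 * (Real.sqrt ((m : ℝ) + 1) - Real.sqrt m) * ((m : ℝ) + 1) ^ 2 := by
    have e : ((m : ℝ) + 1) * Real.sqrt ((m : ℝ) + 1)
          * (2 * (Real.sqrt ((m : ℝ) + 1) - Real.sqrt m) * Real.sqrt ((m : ℝ) + 1))
        = 2 * (Real.sqrt ((m : ℝ) + 1) - Real.sqrt m)
          * (((m : ℝ) + 1) * (Real.sqrt ((m : ℝ) + 1) * Real.sqrt ((m : ℝ) + 1))) := by ring
    rw [e, hsq1]; ring
  linarith

/-! ### The phases: steps and unboundedness -/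

/-- For `n ≥ max(2, 4y)`: `0 < φ_{n+1} − φ_n ≤ 1/2`. -/
theorem phi_step {y : ℝ} (hy : 0 < y) {n : ℕ} (hn : 2 ≤ n) (hny : 4 * y ≤ n) :
    0 < phi y (n + 1) - phi y n ∧ phi y (n + 1) - phi y n ≤ 1 / 2 := by
  have hn0 : (0 : ℝ) < n := by exact_mod_cast (show 0 < n by omega)
  have hn2 : (2 : ℝ) ≤ n := by exact_mod_cast hn
  rw [phi_succ_sub hy.le (by omega)]
  have h0 : (0 : ℝ) < 1 / n := by positivity
  have h1 : (1 : ℝ) / n ≤ 1 / 2 := by rw [div_le_div_iff₀ hn0 (by norm_num)]; linarith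
  have hω0 : 0 < Real.sqrt (y / n) := Real.sqrt_pos.2 (by positivity)
  have hω1 : Real.sqrt (y / n) ≤ 1 / 2 := by
    rw [show (1 / 2 : ℝ) = Real.sqrt ((1 / 2) ^ 2) by rw [Real.sqrt_sq (by norm_num)]]
    apply Real.sqrt_le_sqrt
    rw [div_le_iff₀ hn0]; linarith
  obtain ⟨hs1, hs2⟩ := sqrt_one_add_bounds h0.le (by linarith)
  have e : 1 + (2 * (Real.sqrt (1 + 1 / n) - 1) / (1 / n) - 1) = 2 * (Real.sqrt (1 + 1 / n) - 1) / (1 / n) := by ring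
  rw [e]
  have hlo : 3 / 4 ≤ 2 * (Real.sqrt (1 + 1 / (n : ℝ)) - 1) / (1 / n) := by
    rw [le_div_iff₀ h0]; nlinarith
  have hhi : 2 * (Real.sqrt (1 + 1 / (n : ℝ)) - 1) / (1 / n) ≤ 1 := by
    rw [div_le_iff₀ h0]; nlinarith
  constructor
  · positivity
  · nlinarith

/-- The phases hit every arc of sine `≥ 1/2` beyond any threshold: for `T ≥ max(2, 4y)` and any `α` there is
`p ≥ T` with `sin(α − φ_p) ≥ 1/2`. -/
theorem exists_hit {y : ℝ} (hy : 0 < y) (α : ℝ) {T : ℕ} (hT : 2 ≤ T) (hTy : 4 * y ≤ T) :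
    ∃ p : ℕ, T ≤ p ∧ 1 / 2 ≤ Real.sin (α - phi y p) := by
  classical
  -- a target level `L = α − 5π/6 + 2πk` above `φ_T`
  obtain ⟨k, hk⟩ := exists_nat_gt ((phi y T - (α - 5 * Real.pi / 6)) / (2 * Real.pi))
  set L : ℝ := α - 5 * Real.pi / 6 + 2 * Real.pi * k with hL
  have hLT : phi y T < L := by
    rw [div_lt_iff₀ (by positivity)] at hk; rw [hL]; linarith
  -- some `p ≥ T` with `φ_p ≥ L`
  have hex : ∃ p : ℕ, T ≤ p ∧ L ≤ phi y p := by
    refine ⟨max T ⌈L ^ 2 / y⌉₊, le_max_left _ _, ?_⟩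
    have hp : L ^ 2 / y ≤ (max T ⌈L ^ 2 / y⌉₊ : ℕ) := by
      calc L ^ 2 / y ≤ ⌈L ^ 2 / y⌉₊ := Nat.le_ceil _
        _ ≤ ((max T ⌈L ^ 2 / y⌉₊ : ℕ) : ℝ) := by exact_mod_cast le_max_right _ _
    unfold phi
    have h4 : L ^ 2 ≤ (max T ⌈L ^ 2 / y⌉₊ : ℕ) * y := by rwa [div_le_iff₀ hy] at hp
    have hsq : |L| ≤ Real.sqrt ((max T ⌈L ^ 2 / y⌉₊ : ℕ) * y) := by
      rw [← Real.sqrt_sq_eq_abs]; exact Real.sqrt_le_sqrt h4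
    linarith [le_abs_self L, Real.pi_pos, Real.sqrt_nonneg (((max T ⌈L ^ 2 / y⌉₊ : ℕ) : ℝ) * y)]
  obtain ⟨hp₀T, hp₀L⟩ := Nat.find_spec hex
  have hne : Nat.find hex ≠ T := by
    intro h; rw [h] at hp₀L; linarith
  -- minimality: `φ_{p₀ − 1} < L`
  have hprev : phi y (Nat.find hex - 1) < L := by
    by_contra hcon
    have := Nat.find_min hex (show Nat.find hex - 1 < Nat.find hex by omega)
    exact this ⟨by omega, not_lt.1 hcon⟩
  -- the step from `p₀ − 1` to `p₀` is `≤ 1/2`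
  have hstep := (phi_step hy (n := Nat.find hex - 1) (by omega)
    (hTy.trans (by exact_mod_cast (show T ≤ Nat.find hex - 1 by omega)))).2
  rw [show Nat.find hex - 1 + 1 = Nat.find hex by omega] at hstep
  refine ⟨Nat.find hex, hp₀T, ?_⟩
  have e : Real.sin (α - phi y (Nat.find hex)) = Real.sin (α - phi y (Nat.find hex) + k * (2 * Real.pi)) :=
    (Real.sin_add_nat_mul_two_pi _ k).symm
  rw [e]
  -- `1/2 ≤ sin x` on `[π/6, 5π/6]` (cf. `HanrotLefevreStehleZimmermann2007.half_le_sin_of_mem_Icc`, not imported here)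
  have hx1 : Real.pi / 6 ≤ α - phi y (Nat.find hex) + k * (2 * Real.pi) := by
    have : Real.pi / 6 + 1 / 2 ≤ 5 * Real.pi / 6 := by nlinarith [Real.pi_gt_three]
    linarith [hL]
  have hx2 : α - phi y (Nat.find hex) + k * (2 * Real.pi) ≤ 5 * Real.pi / 6 := by linarith [hL]
  rcases le_or_gt (α - phi y (Nat.find hex) + k * (2 * Real.pi)) (Real.pi / 2) with h | h
  · rw [← Real.sin_pi_div_six]
    exact Real.sin_le_sin_of_le_of_le_pi_div_two (by linarith [Real.pi_pos]) h hx1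
  · rw [← Real.sin_pi_sub, ← Real.sin_pi_div_six]
    exact Real.sin_le_sin_of_le_of_le_pi_div_two (by linarith [Real.pi_pos]) (by linarith) (by linarith)

/-! ### The weak law in the bootstrap's normalisation -/

/-- The weak Fejér law for `E_n = u_n + c Re z_n`, `c = e^{y/2} π^{−1/2} y^{−3/4}`: `|E_n| ≤ e^{y/2} B(y)/π` for
`n ≥ max(2y, 4/y, 1)`, `B(y) = 2 + 4·10⁹/y + 2√y + 1/√y`. -/
theorem weak_bound {y : ℝ} (hy : 0 < y) {n : ℕ} (hn : 2 * y ≤ n) (hn' : 4 / y ≤ n) (hn1 : 1 ≤ n) :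
    |liLaguerreOne n y + Real.exp (y / 2) / Real.sqrt Real.pi * y ^ (-(3 / 4 : ℝ)) * (zm y n).re|
      ≤ Real.exp (y / 2) * (2 + 4 * 10 ^ 9 / y + 2 * Real.sqrt y + 1 / Real.sqrt y) / Real.pi := by
  have hn0 : (0 : ℝ) < n := by exact_mod_cast (show 0 < n by omega)
  have key := bridge_asymptotic hy hn hn' hn1
  have e0 : Real.sqrt Real.pi * Real.sqrt n / (y * Real.sqrt (Real.sqrt (n / y)))
      = Real.sqrt Real.pi * (y ^ (-(3 / 4 : ℝ)) * (n : ℝ) ^ (1 / 4 : ℝ)) := by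
    rw [rpow_quarter_form hy hn0]; ring
  rw [PrimeTail.integral_bridge_eq n hn1 hy, e0] at key
  rw [zm_re, qrt_eq_rpow hn0.le]
  have hπ : 0 < Real.pi := Real.pi_pos
  have hsπ : Real.sqrt Real.pi ≠ 0 := (Real.sqrt_pos.2 hπ).ne'
  have hsπ2 : Real.sqrt Real.pi * Real.sqrt Real.pi = Real.pi := Real.mul_self_sqrt hπ.le
  have hexp : 0 < Real.exp (y / 2) := Real.exp_pos _
  have hee : Real.exp (y / 2) * Real.exp (-(y / 2)) = 1 := by rw [← Real.exp_add]; simp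
  -- multiply the bridge estimate by `e^{y/2}/π`
  have e : liLaguerreOne n y + Real.exp (y / 2) / Real.sqrt Real.pi * y ^ (-(3 / 4 : ℝ))
        * ((n : ℝ) ^ (1 / 4 : ℝ) * Real.cos (phi y n))
      = Real.exp (y / 2) / Real.pi *
        (Real.pi * (Real.exp (-(y / 2)) * liLaguerreOne n y)
          + Real.sqrt Real.pi * (y ^ (-(3 / 4 : ℝ)) * (n : ℝ) ^ (1 / 4 : ℝ))
            * Real.cos (2 * Real.sqrt (n * y) + Real.pi / 4)) := by
    unfold phi
    have h1 : Real.exp (y / 2) / Real.pi * (Real.pi * (Real.exp (-(y / 2)) * liLaguerreOne n y))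
        = liLaguerreOne n y := by
      calc Real.exp (y / 2) / Real.pi * (Real.pi * (Real.exp (-(y / 2)) * liLaguerreOne n y))
          = (Real.exp (y / 2) * Real.exp (-(y / 2))) * liLaguerreOne n y * (Real.pi / Real.pi) := by ring
        _ = liLaguerreOne n y := by rw [hee, div_self hπ.ne']; ring
    have hππ : Real.sqrt Real.pi / Real.pi = 1 / Real.sqrt Real.pi := by
      rw [div_eq_div_iff hπ.ne' hsπ, one_mul, hsπ2]
    have h2 : Real.exp (y / 2) / Real.pi * (Real.sqrt Real.pi * (y ^ (-(3 / 4 : ℝ)) * (n : ℝ) ^ (1 / 4 : ℝ))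
          * Real.cos (2 * Real.sqrt (n * y) + Real.pi / 4))
        = Real.exp (y / 2) / Real.sqrt Real.pi * y ^ (-(3 / 4 : ℝ))
          * ((n : ℝ) ^ (1 / 4 : ℝ) * Real.cos (2 * Real.sqrt (n * y) + Real.pi / 4)) := by
      calc Real.exp (y / 2) / Real.pi * (Real.sqrt Real.pi * (y ^ (-(3 / 4 : ℝ)) * (n : ℝ) ^ (1 / 4 : ℝ))
            * Real.cos (2 * Real.sqrt (n * y) + Real.pi / 4))
          = Real.exp (y / 2) * (Real.sqrt Real.pi / Real.pi) * y ^ (-(3 / 4 : ℝ))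
            * ((n : ℝ) ^ (1 / 4 : ℝ) * Real.cos (2 * Real.sqrt (n * y) + Real.pi / 4)) := by ring
        _ = _ := by rw [hππ]; ring
    rw [mul_add, h1, h2]
  rw [e, abs_mul, abs_of_pos (by positivity), div_mul_eq_mul_div]
  exact div_le_div_of_nonneg_right (mul_le_mul_of_nonneg_left key hexp.le) hπ.le

end Fejer

end Summit.RiemannHypothesis.RiemannHypothesis.Theorems.LiTheory

end
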